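import Literature.NumberTheory.EllipticCurves.WeberGamma2
import Mathlib.NumberTheory.ModularForms.EisensteinSeries.QExpansion
import Mathlib.Analysis.SpecialFunctions.Log.Summable
import HarnessLib

/-!
# Weber's `γ₂` is real on the imaginary axis; `γ₂(i) = 12` (Cox §12.A, the defining property)

Topic `NumberTheory/EllipticCurves`, namespace `Literature.NumberTheory.EllipticCurves.ModularForms`.
Theorem-only companion of `WeberGamma2.lean` (`γ₂ = E₄/η⁸`), except for the point `imagPt y = iy`.
Cox *defines* `γ₂(τ)` as "the unique cube root of `j(τ)` which is real-valued on the imaginary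
axis" (§12.A, before (12.4)); here this is a theorem about `E₄/η⁸`:

* `eta_I_mul_eq_ofReal` — `η(iy)` (`y > 0`) is a positive real number (the `q`-product with
  `q = e^{−2πy} ∈ (0, 1)`; positivity through `∏ = exp ∑ log`, Mathlib `Real.rexp_tsum_eq_tprod`);
* `E₄_imagPt_eq_ofReal` — `E₄(iy)` is real (Mathlib's `q`-expansion
  `EisensteinSeries.q_expansion_bernoulli`, `E₄ = 1 − (8/B₄) ∑ σ₃(n) qⁿ`);
* `weberGamma2_imagPt_eq_ofReal`, `weberGamma2_imagPt_im` — **`γ₂(iy) ∈ ℝ`**;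
  `weberGamma2_I` — **`γ₂(i) = 12`** (the real cube root of `j(i) = 1728`);
  `eq_weberGamma2_of_pow_three_eq` — on the imaginary axis `γ₂(iy)` is the unique real cube root of
  `j(iy)` (Cox's characterisation).

## References

* D. A. Cox, *Primes of the form x² + ny²*, 2nd ed. (2013), §12.A (definition of `γ₂`, (12.5)),
  §10.C (`j(i) = 1728`). [Cox2013]
-/

noncomputable section

open UpperHalfPlane hiding I
open Complex ModularForm EisensteinSeries
open scoped MatrixGroups Real ArithmeticFunction.sigma

namespace Literature.NumberTheory.EllipticCurves.ModularForms

/-- The point `iy ∈ ℍ` for `y > 0`. [folklore] -/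
def imagPt (y : ℝ) (hy : 0 < y) : ℍ := ⟨I * y, by simpa using hy⟩

/-- Underlying complex number of `imagPt`. [folklore] -/
@[simp] theorem coe_imagPt (y : ℝ) (hy : 0 < y) : ((imagPt y hy : ℍ) : ℂ) = I * y := rfl

/-- `imagPt 1 = i`. [folklore] -/
theorem imagPt_one : imagPt 1 one_pos = UpperHalfPlane.I := by
  apply UpperHalfPlane.ext
  simp

/-- `q_h(iy) = e^{−2πy/h}` is real. [folklore] -/
theorem qParam_I_mul (h y : ℝ) :
    Function.Periodic.qParam h (I * y) = ((Real.exp (-(2 * π * y / h)) : ℝ) : ℂ) := by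
  simp only [Function.Periodic.qParam]
  rw [Complex.ofReal_exp]
  congr 1
  push_cast
  have : (2 : ℂ) * π * I * (I * y) = -(2 * π * y) := by
    rw [show (2 : ℂ) * π * I * (I * y) = 2 * π * y * (I * I) by ring, I_mul_I]; ring
  rw [this, neg_div]

/-- **`η(iy)` is a positive real number** (`y > 0`). [folklore] -/
theorem eta_I_mul_eq_ofReal {y : ℝ} (hy : 0 < y) :
    ∃ r : ℝ, 0 < r ∧ η (I * y) = (r : ℂ) := by
  set r : ℝ := Real.exp (-(2 * π * y)) with hr
  have hr0 : 0 < r := Real.exp_pos _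
  have hr1 : r < 1 := by
    rw [hr, ← Real.exp_zero]
    exact Real.exp_lt_exp.mpr (by nlinarith [Real.pi_pos])
  set f : ℕ → ℝ := fun n => 1 - r ^ (n + 1) with hf
  have hfpos : ∀ n, 0 < f n := fun n => by
    have : r ^ (n + 1) < 1 := pow_lt_one₀ hr0.le hr1 (Nat.succ_ne_zero n)
    simp only [hf]; linarith
  have hlog : Summable fun n => Real.log (f n) := by
    have hs : Summable fun n : ℕ => -(r ^ (n + 1)) := by
      apply Summable.neg
      simpa using (summable_nat_add_iff 1).mpr (summable_geometric_of_lt_one hr0.le hr1)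
    have := Real.summable_log_one_add_of_summable hs
    refine this.congr fun n => ?_
    simp only [hf]
    ring_nf
  have hmult : Multipliable f := Real.multipliable_of_summable_log hfpos hlog
  have hprodpos : 0 < ∏' n, f n := by
    rw [← Real.rexp_tsum_eq_tprod hfpos hlog]; exact Real.exp_pos _
  refine ⟨Real.exp (-(2 * π * y / 24)) * ∏' n, f n, mul_pos (Real.exp_pos _) hprodpos, ?_⟩
  rw [ModularForm.eta, qParam_I_mul]
  push_cast
  congr 1
  rw [show ((∏' n, f n : ℝ) : ℂ) = Complex.ofRealHom (∏' n, f n) from rfl,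
    Multipliable.map_tprod hmult Complex.ofRealHom Complex.continuous_ofReal]
  apply tprod_congr
  intro n
  simp only [eta_q, qParam_I_mul, Complex.ofRealHom_eq_coe, hf, div_one]
  push_cast
  rw [hr]
  push_cast
  rfl

/-- **`E₄(iy)` is real** (`y > 0`). [folklore] -/
theorem E₄_imagPt_eq_ofReal {y : ℝ} (hy : 0 < y) : ∃ r : ℝ, E₄ (imagPt y hy) = (r : ℂ) := by
  have h := EisensteinSeries.q_expansion_bernoulli (k := 4) (by norm_num) (by decide) (imagPt y hy)
  have hq : cexp (2 * π * I * (imagPt y hy : ℂ)) = ((Real.exp (-(2 * π * y)) : ℝ) : ℂ) := by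
    have := qParam_I_mul 1 y
    simp only [Function.Periodic.qParam, Complex.ofReal_one, div_one] at this
    rw [coe_imagPt, this]
  set r : ℝ := Real.exp (-(2 * π * y)) with hr
  refine ⟨1 - (2 * 4 / (bernoulli 4 : ℝ)) * ∑' n : ℕ+, (σ 3 n : ℝ) * r ^ (n : ℤ), ?_⟩
  change E (by norm_num : 3 ≤ 4) (imagPt y hy) = _
  rw [h, hq]
  push_cast
  ring

/-- **`γ₂` is real on the imaginary axis**: `γ₂(iy) ∈ ℝ` for `y > 0` (Cox §12.A: the defining
property of Weber's `γ₂`, here a consequence of `γ₂ = E₄/η⁸`). [cite: Cox2013, §12.A before (12.4)] -/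
theorem weberGamma2_imagPt_eq_ofReal {y : ℝ} (hy : 0 < y) :
    ∃ w : ℝ, weberGamma2 (imagPt y hy) = (w : ℂ) := by
  obtain ⟨r, -, hr⟩ := eta_I_mul_eq_ofReal hy
  obtain ⟨s, hs⟩ := E₄_imagPt_eq_ofReal hy
  refine ⟨s / r ^ 8, ?_⟩
  rw [weberGamma2, hs, coe_imagPt, hr]
  push_cast
  rfl

/-- `γ₂(iy)` has vanishing imaginary part. [cite: Cox2013, §12.A before (12.4)] -/
theorem weberGamma2_imagPt_im {y : ℝ} (hy : 0 < y) : (weberGamma2 (imagPt y hy)).im = 0 := by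
  obtain ⟨w, hw⟩ := weberGamma2_imagPt_eq_ofReal hy
  rw [hw, Complex.ofReal_im]

/-- A real number whose cube is `1728` is `12`. [folklore] -/
theorem eq_twelve_of_pow_three_eq {w : ℝ} (h : w ^ 3 = 1728) : w = 12 := by
  have h1 : (w - 12) * (w ^ 2 + 12 * w + 144) = 0 := by nlinarith [h]
  rcases mul_eq_zero.mp h1 with h2 | h2
  · linarith
  · nlinarith [sq_nonneg (w + 6)]

/-- **`γ₂(i) = 12`**: the real cube root of `j(i) = 1728 = 12³` (Cox §12.A / §10.C).
[cite: Cox2013, §12.A and §10.C (`j(i) = 1728`)] -/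
theorem weberGamma2_I : weberGamma2 UpperHalfPlane.I = 12 := by
  obtain ⟨w, hw⟩ := weberGamma2_imagPt_eq_ofReal one_pos
  rw [imagPt_one] at hw
  have h3 : ((w : ℂ)) ^ 3 = 1728 := by rw [← hw, weberGamma2_pow_three, kleinJ_I]
  have h3' : w ^ 3 = 1728 := by exact_mod_cast h3
  rw [hw, eq_twelve_of_pow_three_eq h3']
  norm_num

/-- **Cox's characterisation on the imaginary axis**: a real number `w` with `w³ = j(iy)` is
`γ₂(iy)` (real cube roots of real numbers are unique). [cite: Cox2013, §12.A before (12.4)] -/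
theorem eq_weberGamma2_of_pow_three_eq {y : ℝ} (hy : 0 < y) {w : ℝ}
    (h : (w : ℂ) ^ 3 = kleinJ (imagPt y hy)) : (w : ℂ) = weberGamma2 (imagPt y hy) := by
  obtain ⟨g, hg⟩ := weberGamma2_imagPt_eq_ofReal hy
  have h3 : ((w : ℂ)) ^ 3 = (g : ℂ) ^ 3 := by rw [h, ← hg, weberGamma2_pow_three]
  have h3' : w ^ 3 = g ^ 3 := by exact_mod_cast h3
  have hwg : w = g := (Odd.strictMono_pow (by decide : Odd 3)).injective h3'
  rw [hg, hwg]

end Literature.NumberTheory.EllipticCurves.ModularForms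

end
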